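import Mathlib
import HarnessLib
import Summits.Ventures.LatticeQCDFlow.Exactness.SphereTiltedGreen

/-!
# The constants of Lüscher's recursion on the lattice of site spheres satisfy the moment identity of the action: `Σ_{i≤k} ċ_i·m_{k−i}/(k−i)! = m_{k+1}/k!` (`m_j = ∫(−S)^j dπ̄`) for every `C²` Lüscher series — `Ċ·Z = Z′` coefficientwise; `ċ₀ = m₁`, `ċ₁ = m₂ − m₁²`, `ċ₂ = (m₃ − 3m₁m₂ + 2m₁³)/2`

HONEST FRAMING: exact (Metropolis-corrected) sampling algorithms for lattice gauge theory;
figures of merit are autocorrelation/cost numbers at stated couplings and volumes; no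
continuum-physics claim.

Venture `LatticeQCDFlow` (cell pub-lqcd), topic `Exactness`; FANOUT row 7 (`s0-cpn-null`).  NEW WORK
of the cell over the tree's `Exactness/SphereTiltedGreen.lean` (this leg: the chain rule
`∂̃_n(g∘F) = g′(F)∂̃_nF` on `Ω`, `∂̃_nS^{j+1} = (j+1)S^j∂̃_nS`), `Exactness/SphereLuscherSeriesConstants.lean`
(GEN-11: the polarised Green identity under `π̄`, `integral_mul_neg_luscher_uniform`) and
`Exactness/SphereLuscherRecursionVariance.lean` (`∫Σ∂̃²F dπ̄ = 0`); nothing is cited as a fact.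
Printed counterpart, NAMED ONLY: M. Lüscher, Commun. Math. Phys. 293 (2010) 899, §4.2 eqs.
(4.9)–(4.10): `Ċ_t = −(1,S)_t/(1,1)_t = (d/dt)ln⟨e^{−tS}⟩`, so that, writing `Z(t) = ⟨e^{−tS}⟩ = Σ_j m_j t^j/j!`
with `m_j` the moments of `−S` under the a-priori measure, `Ċ(t)·Z(t) = Z′(t)` as formal power series.
The gauge-side file `TrivializingMaps/ConstantsCumulants.lean` (theory-1) proves this coefficient
identity for `SU(n)^E`; the sphere side had only `ċ₀ = −S₀` (GEN-8) and `ċ₁ = Var_π̄(S)` (GEN-11, for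
the E–S action).  THIS FILE proves the coefficient identity AT ALL ORDERS for the lattice of site
spheres `Ω = S(E)^Λ` (general finite-dimensional `E`, `Λ` finite), for every `C¹` action `S` and every
`C²` Lüscher series, with nothing but Green's identity and a telescoping sum (no flow, no analysis in
`t`); the sequel `Exactness/SphereLuscherCumulants.lean` identifies the `ċ_k` with the cumulants
`(d/dt)^{k+1}log∫e^{−tS}dπ̄|₀ / k!` of Mathlib's `cgf`, and `Exactness/SphereLuscherNormalization.lean`
has the finite-`t` form with remainder.

## Content (`V = −S` read on `Ω`, `m_j = ∫V^j dπ̄`; Lüscher series in the tree's convention: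
`−Σ∂̃²S̃⁽⁰⁾ = S + ċ₀`, `−Σ∂̃²S̃⁽ᵏ⁺¹⁾ = −Σ_n⟪∂̃_nS, ∂̃_nS̃⁽ᵏ⁾⟫ + ċ_{k+1}` on `Ω`)

* §1 `siteGrad_neg_sphere`, **`integral_pow_succ_mul_neg_luscher`** (Green with a power weight:
  `∫V^{j+1}·(−Σ∂̃²F)dπ̄ = −(j+1)·∫V^j·Σ_n⟪∂̃_nS, ∂̃_nF⟫dπ̄`), the pairings of the recursion with `V^j`
  (`integral_pow_mul_luscher_zero/_succ`) and the telescoping law **`luscher_pairing_telescope`**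
  (`∫V^j(−Σ∂̃²S̃⁽ᵏ⁾)dπ̄/j! = −m_{j+k+1}/(j+k)! + Σ_{l≤k} ċ_l·m_{j+k−l}/(j+k−l)!`).
* §2 **`luscher_constant_moment_identity`** — for every `k`:
  `Σ_{i≤k} ċ_i·m_{k−i}/(k−i)! = m_{k+1}/k!`; low orders **`luscher_constant_zero_eq`**
  (`ċ₀ = m₁ = −∫S dπ̄`), **`luscher_constant_one_eq_variance`** (`ċ₁ = m₂ − m₁²`, the variance of the
  action — GEN-11's E–S statement for every `C¹` action), **`luscher_constant_two_eq`**
  (`ċ₂ = (m₃ − 3m₁m₂ + 2m₁³)/2`, half the third cumulant — new).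

NOT CLAIMED: convergence of `Σt^kS̃⁽ᵏ⁾` or of `Σt^kċ_k`; closed forms of the moments for the E–S
action beyond order 2 (GEN-11: `m₂ − m₁² = (2κ²/d²)Σ‖U_nm‖²_HS`); anything about the rung.
-/

noncomputable section

namespace Summit.Ventures.LatticeQCDFlow.Exactness

open Function Set Metric MeasureTheory NormedSpace InnerProductSpace ProbabilityTheory
open scoped RealInnerProductSpace Nat

variable {Λ : Type*} {E : Type*} [NormedAddCommGroup E] [InnerProductSpace ℝ E]
  [FiniteDimensional ℝ E] [MeasurableSpace E] [BorelSpace E] [Fintype Λ] [DecidableEq Λ] [Nontrivial E]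

/-! ## §1 Green with a power weight; pairing the recursion with powers of `V = −S` -/

section Pairing

variable {S : (Λ → E) → ℝ} {St : ℕ → (Λ → E) → ℝ} {c : ℕ → ℝ}

omit [MeasurableSpace E] [BorelSpace E] [Nontrivial E] in
/-- `∂̃_n(−S) = −∂̃_nS` on `Ω` (`S ∈ C¹`). -/
theorem siteGrad_neg_sphere (hS : ContDiff ℝ 1 S) (ω : Λ → sphere (0 : E) 1) (n : Λ) :
    siteGrad n (fun z => -S z) (fun m => (ω m : E)) = -siteGrad n S (fun m => (ω m : E)) := by
  have h := siteGrad_comp_sphere hS (g := fun s : ℝ => -s) (g' := -1) ω n (hasDerivAt_neg _)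
  rw [neg_one_smul] at h
  exact h

/-- **Green with a power weight**: `∫ V^{j+1}·(−Σ_n∂̃_n·∂̃_nF) dπ̄ = −(j+1)·∫ V^j·Σ_n⟪∂̃_nS, ∂̃_nF⟫ dπ̄`
for `V = −S`, `S ∈ C¹`, `F ∈ C²` (polarised Green and `∂̃V^{j+1} = (j+1)V^j∂̃V = −(j+1)V^j∂̃S`). -/
theorem integral_pow_succ_mul_neg_luscher (hS : ContDiff ℝ 1 S) {F : (Λ → E) → ℝ}
    (hF : ContDiff ℝ 2 F) (j : ℕ) :
    ∫ ω, (-S (fun m => ((ω : Λ → sphere (0 : E) 1) m : E))) ^ (j + 1) *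
        -∑ n, siteLaplacian n F (fun m => (ω m : E))
          ∂Measure.pi (fun _ : Λ => uniformSphere (volume : Measure E)) =
      -((j : ℝ) + 1) * ∫ ω, (-S (fun m => ((ω : Λ → sphere (0 : E) 1) m : E))) ^ j *
          ∑ n, ⟪siteGrad n S (fun m => (ω m : E)), siteGrad n F (fun m => (ω m : E))⟫
            ∂Measure.pi (fun _ : Λ => uniformSphere (volume : Measure E)) := by
  set μ : Measure (sphere (0 : E) 1) := uniformSphere (volume : Measure E) with hμ
  have hV : ContDiff ℝ 1 (fun z : Λ → E => -S z) := hS.neg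
  have hVp : ContDiff ℝ 1 (fun z : Λ → E => (-S z) ^ (j + 1)) := hV.pow (j + 1)
  have hgreen := integral_mul_neg_luscher_uniform (Λ := Λ) hF hVp
  have hpt : ∀ (n : Λ) (ω : Λ → sphere (0 : E) 1),
      ⟪siteGrad n (fun z : Λ → E => (-S z) ^ (j + 1)) (fun m => (ω m : E)),
          siteGrad n F (fun m => (ω m : E))⟫ =
        -((j : ℝ) + 1) * ((-S (fun m => (ω m : E))) ^ j *
          ⟪siteGrad n S (fun m => (ω m : E)), siteGrad n F (fun m => (ω m : E))⟫) := by
    intro n ω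
    rw [siteGrad_pow_succ hV j ω n, siteGrad_neg_sphere hS ω n, real_inner_smul_left,
      inner_neg_left]
    ring
  simp_rw [hpt] at hgreen
  rw [hgreen]
  have hi : ∀ n, Integrable (fun ω : Λ → sphere (0 : E) 1 =>
      (-S (fun m => (ω m : E))) ^ j *
        ⟪siteGrad n S (fun m => (ω m : E)), siteGrad n F (fun m => (ω m : E))⟫)
          (Measure.pi fun _ : Λ => μ) := fun n =>
    integrable_pi_of_continuous μ (((hS.continuous.comp continuous_sphereConfig).neg.pow j).mul
      (continuous_inner_siteGrad (hF.of_le (by norm_num)) hS n n))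
  simp_rw [integral_const_mul]
  rw [← Finset.mul_sum, ← integral_finsetSum _ fun n _ => hi n]
  congr 1
  refine integral_congr_ae (ae_of_all _ fun ω => ?_)
  simp only
  rw [Finset.mul_sum]

/-- Order `0` paired with `V^j`: `∫V^j(−Σ∂̃²S̃⁽⁰⁾)dπ̄ = −m_{j+1} + ċ₀·m_j`. -/
theorem integral_pow_mul_luscher_zero (hS : ContDiff ℝ 1 S)
    (h0 : ∀ ξ : Λ → sphere (0 : E) 1,
      -∑ n, siteLaplacian n (St 0) (fun m => (ξ m : E)) = S (fun m => (ξ m : E)) + c 0) (j : ℕ) :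
    ∫ ω, (-S (fun m => ((ω : Λ → sphere (0 : E) 1) m : E))) ^ j *
        -∑ n, siteLaplacian n (St 0) (fun m => (ω m : E))
          ∂Measure.pi (fun _ : Λ => uniformSphere (volume : Measure E)) =
      -∫ ω, (-S (fun m => ((ω : Λ → sphere (0 : E) 1) m : E))) ^ (j + 1)
          ∂Measure.pi (fun _ : Λ => uniformSphere (volume : Measure E)) +
        c 0 * ∫ ω, (-S (fun m => ((ω : Λ → sphere (0 : E) 1) m : E))) ^ j
          ∂Measure.pi (fun _ : Λ => uniformSphere (volume : Measure E)) := by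
  set μ : Measure (sphere (0 : E) 1) := uniformSphere (volume : Measure E) with hμ
  have hVc : Continuous fun ω : Λ → sphere (0 : E) 1 => -S (fun m => (ω m : E)) :=
    (hS.continuous.comp continuous_sphereConfig).neg
  have hpt : ∀ ω : Λ → sphere (0 : E) 1,
      (-S (fun m => (ω m : E))) ^ j * -∑ n, siteLaplacian n (St 0) (fun m => (ω m : E)) =
        -((-S (fun m => (ω m : E))) ^ (j + 1)) + c 0 * (-S (fun m => (ω m : E))) ^ j := fun ω => by
    rw [h0 ω]; ring
  simp_rw [hpt]
  have hi1 : Integrable (fun ω : Λ → sphere (0 : E) 1 => -((-S (fun m => (ω m : E))) ^ (j + 1)))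
      (Measure.pi fun _ : Λ => μ) := (integrable_pi_of_continuous μ (hVc.pow (j + 1))).neg
  have hi2 : Integrable (fun ω : Λ → sphere (0 : E) 1 => c 0 * (-S (fun m => (ω m : E))) ^ j)
      (Measure.pi fun _ : Λ => μ) := (integrable_pi_of_continuous μ (hVc.pow j)).const_mul _
  rw [integral_add hi1 hi2, integral_neg, integral_const_mul]

/-- Order `i+1` paired with `V^j`: `∫V^j(−Σ∂̃²S̃⁽ⁱ⁺¹⁾)dπ̄ = −∫V^jΣ_n⟪∂̃_nS, ∂̃_nS̃⁽ⁱ⁾⟫dπ̄ + ċ_{i+1}·m_j`. -/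
theorem integral_pow_mul_luscher_succ (hS : ContDiff ℝ 1 S) (hSt : ∀ k, ContDiff ℝ 2 (St k))
    (hs : ∀ k, ∀ ξ : Λ → sphere (0 : E) 1,
      -∑ n, siteLaplacian n (St (k + 1)) (fun m => (ξ m : E)) =
        -(∑ n, ⟪siteGrad n S (fun m => (ξ m : E)), siteGrad n (St k) (fun m => (ξ m : E))⟫) +
          c (k + 1)) (j i : ℕ) :
    ∫ ω, (-S (fun m => ((ω : Λ → sphere (0 : E) 1) m : E))) ^ j *
        -∑ n, siteLaplacian n (St (i + 1)) (fun m => (ω m : E))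
          ∂Measure.pi (fun _ : Λ => uniformSphere (volume : Measure E)) =
      -∫ ω, (-S (fun m => ((ω : Λ → sphere (0 : E) 1) m : E))) ^ j *
          ∑ n, ⟪siteGrad n S (fun m => (ω m : E)), siteGrad n (St i) (fun m => (ω m : E))⟫
            ∂Measure.pi (fun _ : Λ => uniformSphere (volume : Measure E)) +
        c (i + 1) * ∫ ω, (-S (fun m => ((ω : Λ → sphere (0 : E) 1) m : E))) ^ j
          ∂Measure.pi (fun _ : Λ => uniformSphere (volume : Measure E)) := by
  set μ : Measure (sphere (0 : E) 1) := uniformSphere (volume : Measure E) with hμ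
  have hVc : Continuous fun ω : Λ → sphere (0 : E) 1 => -S (fun m => (ω m : E)) :=
    (hS.continuous.comp continuous_sphereConfig).neg
  have hW : Continuous fun ω : Λ → sphere (0 : E) 1 =>
      ∑ n, ⟪siteGrad n S (fun m => (ω m : E)), siteGrad n (St i) (fun m => (ω m : E))⟫ :=
    continuous_finsetSum _ fun n _ => continuous_inner_siteGrad ((hSt i).of_le (by norm_num)) hS n n
  have hpt : ∀ ω : Λ → sphere (0 : E) 1,
      (-S (fun m => (ω m : E))) ^ j * -∑ n, siteLaplacian n (St (i + 1)) (fun m => (ω m : E)) =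
        -((-S (fun m => (ω m : E))) ^ j *
            ∑ n, ⟪siteGrad n S (fun m => (ω m : E)), siteGrad n (St i) (fun m => (ω m : E))⟫) +
          c (i + 1) * (-S (fun m => (ω m : E))) ^ j := fun ω => by
    rw [hs i ω]; ring
  simp_rw [hpt]
  have hi1 : Integrable (fun ω : Λ → sphere (0 : E) 1 => -((-S (fun m => (ω m : E))) ^ j *
      ∑ n, ⟪siteGrad n S (fun m => (ω m : E)), siteGrad n (St i) (fun m => (ω m : E))⟫))
        (Measure.pi fun _ : Λ => μ) := (integrable_pi_of_continuous μ ((hVc.pow j).mul hW)).neg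
  have hi2 : Integrable (fun ω : Λ → sphere (0 : E) 1 => c (i + 1) * (-S (fun m => (ω m : E))) ^ j)
      (Measure.pi fun _ : Λ => μ) := (integrable_pi_of_continuous μ (hVc.pow j)).const_mul _
  rw [integral_add hi1 hi2, integral_neg, integral_const_mul]

/-- **The telescoping law.**  Along the recursion, for every `k` and `j`:
`∫V^j(−Σ∂̃²S̃⁽ᵏ⁾)dπ̄/j! = −m_{j+k+1}/(j+k)! + Σ_{l≤k} ċ_l·m_{j+k−l}/(j+k−l)!`. -/
theorem luscher_pairing_telescope (hS : ContDiff ℝ 1 S) (hSt : ∀ k, ContDiff ℝ 2 (St k))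
    (h0 : ∀ ξ : Λ → sphere (0 : E) 1,
      -∑ n, siteLaplacian n (St 0) (fun m => (ξ m : E)) = S (fun m => (ξ m : E)) + c 0)
    (hs : ∀ k, ∀ ξ : Λ → sphere (0 : E) 1,
      -∑ n, siteLaplacian n (St (k + 1)) (fun m => (ξ m : E)) =
        -(∑ n, ⟪siteGrad n S (fun m => (ξ m : E)), siteGrad n (St k) (fun m => (ξ m : E))⟫) +
          c (k + 1)) :
    ∀ k j : ℕ,
      (∫ ω, (-S (fun m => ((ω : Λ → sphere (0 : E) 1) m : E))) ^ j *
          -∑ n, siteLaplacian n (St k) (fun m => (ω m : E))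
            ∂Measure.pi (fun _ : Λ => uniformSphere (volume : Measure E))) / (j ! : ℝ) =
        -(∫ ω, (-S (fun m => ((ω : Λ → sphere (0 : E) 1) m : E))) ^ (j + k + 1)
            ∂Measure.pi (fun _ : Λ => uniformSphere (volume : Measure E))) / ((j + k)! : ℝ) +
          ∑ l ∈ Finset.range (k + 1), c l *
            (∫ ω, (-S (fun m => ((ω : Λ → sphere (0 : E) 1) m : E))) ^ (j + k - l)
              ∂Measure.pi (fun _ : Λ => uniformSphere (volume : Measure E))) / ((j + k - l)! : ℝ)
  | 0, j => by
      rw [integral_pow_mul_luscher_zero hS h0 j, Finset.sum_range_one]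
      simp only [add_zero, Nat.sub_zero]
      ring
  | k + 1, j => by
      have ih := luscher_pairing_telescope hS hSt h0 hs k (j + 1)
      have hj : ((j + 1)! : ℝ) = ((j : ℝ) + 1) * (j ! : ℝ) := by
        rw [Nat.factorial_succ]; push_cast; ring
      have hj0 : (j ! : ℝ) ≠ 0 := by positivity
      have hj1 : ((j : ℝ) + 1) ≠ 0 := by positivity
      -- `∫V^j(−Σ∂̃²S̃⁽ᵏ⁺¹⁾)/j! = ∫V^{j+1}(−Σ∂̃²S̃⁽ᵏ⁾)/(j+1)! + ċ_{k+1} m_j/j!`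
      have hstep : (∫ ω, (-S (fun m => ((ω : Λ → sphere (0 : E) 1) m : E))) ^ j *
            -∑ n, siteLaplacian n (St (k + 1)) (fun m => (ω m : E))
              ∂Measure.pi (fun _ : Λ => uniformSphere (volume : Measure E))) / (j ! : ℝ) =
          (∫ ω, (-S (fun m => ((ω : Λ → sphere (0 : E) 1) m : E))) ^ (j + 1) *
              -∑ n, siteLaplacian n (St k) (fun m => (ω m : E))
                ∂Measure.pi (fun _ : Λ => uniformSphere (volume : Measure E))) / ((j + 1)! : ℝ) +
            c (k + 1) * (∫ ω, (-S (fun m => ((ω : Λ → sphere (0 : E) 1) m : E))) ^ j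
              ∂Measure.pi (fun _ : Λ => uniformSphere (volume : Measure E))) / (j ! : ℝ) := by
        have key : ∀ B M : ℝ, (-B + c (k + 1) * M) / (j ! : ℝ) =
            -((j : ℝ) + 1) * B / (((j : ℝ) + 1) * (j ! : ℝ)) + c (k + 1) * M / (j ! : ℝ) := by
          intro B M
          rw [show -((j : ℝ) + 1) * B / (((j : ℝ) + 1) * (j ! : ℝ)) = -B / (j ! : ℝ) by
            rw [neg_mul, neg_div, neg_div, mul_div_mul_left _ _ hj1]]
          ring
        rw [integral_pow_mul_luscher_succ hS hSt hs j k, integral_pow_succ_mul_neg_luscher hS (hSt k) j,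
          hj]
        exact key _ _
      rw [hstep, ih, Finset.sum_range_succ (fun l => c l * _ / _) (k + 1)]
      have e1 : j + 1 + k + 1 = j + (k + 1) + 1 := by ring
      have e2 : j + 1 + k = j + (k + 1) := by ring
      rw [e1, e2, Nat.add_sub_cancel]
      ring

end Pairing

/-! ## §2 The moment identity `Σ_{i≤k} ċ_i m_{k−i}/(k−i)! = m_{k+1}/k!` and its low orders -/

section Moments

variable {S : (Λ → E) → ℝ} {St : ℕ → (Λ → E) → ℝ} {c : ℕ → ℝ}

/-- **THE CONSTANTS OF LÜSCHER'S RECURSION SATISFY THE MOMENT IDENTITY OF `−S`**: for every `C¹`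
action `S` on `Ω`, every `C²` Lüscher series `(S̃⁽ᵏ⁾, ċ_k)` of `S` and every `k`,
`Σ_{i≤k} ċ_i · m_{k−i}/(k−i)! = m_{k+1}/k!` with `m_j = ∫(−S)^j dπ̄` — coefficientwise
`Ċ(t)·Z(t) = Z′(t)` for the exponential moment generating function `Z(t) = ∫e^{−tS}dπ̄`
(Lüscher's (4.9), with no flow and no analysis in `t`: Green's identity and telescoping only). -/
theorem luscher_constant_moment_identity (hS : ContDiff ℝ 1 S) (hSt : ∀ k, ContDiff ℝ 2 (St k))
    (h0 : ∀ ξ : Λ → sphere (0 : E) 1,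
      -∑ n, siteLaplacian n (St 0) (fun m => (ξ m : E)) = S (fun m => (ξ m : E)) + c 0)
    (hs : ∀ k, ∀ ξ : Λ → sphere (0 : E) 1,
      -∑ n, siteLaplacian n (St (k + 1)) (fun m => (ξ m : E)) =
        -(∑ n, ⟪siteGrad n S (fun m => (ξ m : E)), siteGrad n (St k) (fun m => (ξ m : E))⟫) +
          c (k + 1)) (k : ℕ) :
    ∑ i ∈ Finset.range (k + 1), c i *
        (∫ ω, (-S (fun m => ((ω : Λ → sphere (0 : E) 1) m : E))) ^ (k - i)
          ∂Measure.pi (fun _ : Λ => uniformSphere (volume : Measure E))) / ((k - i)! : ℝ) =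
      (∫ ω, (-S (fun m => ((ω : Λ → sphere (0 : E) 1) m : E))) ^ (k + 1)
          ∂Measure.pi (fun _ : Λ => uniformSphere (volume : Measure E))) / (k ! : ℝ) := by
  have ht := luscher_pairing_telescope hS hSt h0 hs k 0
  have hzero : ∫ ω, (-S (fun m => ((ω : Λ → sphere (0 : E) 1) m : E))) ^ 0 *
      -∑ n, siteLaplacian n (St k) (fun m => (ω m : E))
        ∂Measure.pi (fun _ : Λ => uniformSphere (volume : Measure E)) = 0 := by
    simp_rw [pow_zero, one_mul, integral_neg, integral_luscher_uniform_eq_zero (hSt k), neg_zero]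
  rw [hzero, zero_div] at ht
  simp only [zero_add] at ht
  linear_combination (-1 : ℝ) * ht

/-- **`ċ₀ = m₁ = −∫S dπ̄`** (order zero: the mean; for the E–S action `−S₀`, GEN-8). -/
theorem luscher_constant_zero_eq (hS : ContDiff ℝ 1 S) (hSt : ∀ k, ContDiff ℝ 2 (St k))
    (h0 : ∀ ξ : Λ → sphere (0 : E) 1,
      -∑ n, siteLaplacian n (St 0) (fun m => (ξ m : E)) = S (fun m => (ξ m : E)) + c 0)
    (hs : ∀ k, ∀ ξ : Λ → sphere (0 : E) 1,
      -∑ n, siteLaplacian n (St (k + 1)) (fun m => (ξ m : E)) =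
        -(∑ n, ⟪siteGrad n S (fun m => (ξ m : E)), siteGrad n (St k) (fun m => (ξ m : E))⟫) +
          c (k + 1)) :
    c 0 = ∫ ω, -S (fun m => ((ω : Λ → sphere (0 : E) 1) m : E))
      ∂Measure.pi (fun _ : Λ => uniformSphere (volume : Measure E)) := by
  have h := luscher_constant_moment_identity hS hSt h0 hs 0
  simp only [Finset.sum_range_one, Nat.sub_self, pow_zero, Nat.factorial_zero, Nat.cast_one,
    div_one, zero_add, pow_one, integral_const, smul_eq_mul, mul_one, Measure.real, measure_univ,
    ENNReal.toReal_one] at h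
  exact h

/-- **`ċ₁ = m₂ − m₁²`** — the variance of the action (order one; for the E–S action GEN-11's
`luscher_constant_one_eq`, here for every `C¹` action). -/
theorem luscher_constant_one_eq_variance (hS : ContDiff ℝ 1 S) (hSt : ∀ k, ContDiff ℝ 2 (St k))
    (h0 : ∀ ξ : Λ → sphere (0 : E) 1,
      -∑ n, siteLaplacian n (St 0) (fun m => (ξ m : E)) = S (fun m => (ξ m : E)) + c 0)
    (hs : ∀ k, ∀ ξ : Λ → sphere (0 : E) 1,
      -∑ n, siteLaplacian n (St (k + 1)) (fun m => (ξ m : E)) =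
        -(∑ n, ⟪siteGrad n S (fun m => (ξ m : E)), siteGrad n (St k) (fun m => (ξ m : E))⟫) +
          c (k + 1)) :
    c 1 = ∫ ω, (-S (fun m => ((ω : Λ → sphere (0 : E) 1) m : E))) ^ 2
        ∂Measure.pi (fun _ : Λ => uniformSphere (volume : Measure E)) -
      (∫ ω, -S (fun m => ((ω : Λ → sphere (0 : E) 1) m : E))
        ∂Measure.pi (fun _ : Λ => uniformSphere (volume : Measure E))) ^ 2 := by
  have h1 := luscher_constant_moment_identity hS hSt h0 hs 1
  have h0' := luscher_constant_zero_eq hS hSt h0 hs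
  rw [Finset.sum_range_succ, Finset.sum_range_one] at h1
  simp only [Nat.sub_zero, Nat.sub_self, pow_zero, pow_one, Nat.factorial_one, Nat.factorial_zero,
    Nat.cast_one, div_one, integral_const, smul_eq_mul, mul_one, Measure.real, measure_univ,
    ENNReal.toReal_one] at h1
  rw [h0', show 1 + 1 = 2 from rfl] at h1
  linear_combination h1

/-- **`ċ₂ = (m₃ − 3m₁m₂ + 2m₁³)/2`** — half the third cumulant of `−S` under `π̄` (order two; new). -/
theorem luscher_constant_two_eq (hS : ContDiff ℝ 1 S) (hSt : ∀ k, ContDiff ℝ 2 (St k))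
    (h0 : ∀ ξ : Λ → sphere (0 : E) 1,
      -∑ n, siteLaplacian n (St 0) (fun m => (ξ m : E)) = S (fun m => (ξ m : E)) + c 0)
    (hs : ∀ k, ∀ ξ : Λ → sphere (0 : E) 1,
      -∑ n, siteLaplacian n (St (k + 1)) (fun m => (ξ m : E)) =
        -(∑ n, ⟪siteGrad n S (fun m => (ξ m : E)), siteGrad n (St k) (fun m => (ξ m : E))⟫) +
          c (k + 1)) :
    c 2 = ((∫ ω, (-S (fun m => ((ω : Λ → sphere (0 : E) 1) m : E))) ^ 3
        ∂Measure.pi (fun _ : Λ => uniformSphere (volume : Measure E))) -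
      3 * (∫ ω, -S (fun m => ((ω : Λ → sphere (0 : E) 1) m : E))
        ∂Measure.pi (fun _ : Λ => uniformSphere (volume : Measure E))) *
        (∫ ω, (-S (fun m => ((ω : Λ → sphere (0 : E) 1) m : E))) ^ 2
          ∂Measure.pi (fun _ : Λ => uniformSphere (volume : Measure E))) +
      2 * (∫ ω, -S (fun m => ((ω : Λ → sphere (0 : E) 1) m : E))
        ∂Measure.pi (fun _ : Λ => uniformSphere (volume : Measure E))) ^ 3) / 2 := by
  have h2 := luscher_constant_moment_identity hS hSt h0 hs 2
  have h1' := luscher_constant_one_eq_variance hS hSt h0 hs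
  have h0' := luscher_constant_zero_eq hS hSt h0 hs
  rw [Finset.sum_range_succ, Finset.sum_range_succ, Finset.sum_range_one] at h2
  simp only [Nat.sub_zero, Nat.sub_self, show 2 - 1 = 1 from rfl, pow_zero, pow_one,
    Nat.factorial_two, Nat.factorial_one, Nat.factorial_zero, Nat.cast_one, Nat.cast_ofNat, div_one,
    integral_const, smul_eq_mul, mul_one, Measure.real, measure_univ, ENNReal.toReal_one] at h2
  rw [h0', h1', show 2 + 1 = 3 from rfl] at h2
  linear_combination h2

end Moments

end Summit.Ventures.LatticeQCDFlow.Exactness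

end
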